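import Literature.LinearAlgebra.Semilinear.HermitianOrthogonalBasis
import HarnessLib

/-!
# Adapted frames of a non-degenerate hermitian space through an isotropic vector ([Lang2002, Ch. XV §5]; Witt)

Topic `LinearAlgebra/Semilinear`; namespace `Literature.LinearAlgebra.Semilinear`.  KERNEL ONLY: theorems; no definition,
no named fact, no `sorry`.  Sequel of `HermitianOrthogonalBasis.lean`.

Setting: `K` a field with `2 ≠ 0`, `J : K →+* K` a ring endomorphism moving some `δ ≠ 0` to `-δ`, `V` a finite-dimensional
`K`-space and `B : V →ₛₗ[J] V →ₗ[K] K` a HERMITIAN (`LinearMap.IsSymm`: `J (B x y) = B y x`) form which is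
NON-DEGENERATE (`LinearMap.SeparatingLeft`).  For a non-zero ISOTROPIC vector `x₀` (`B x₀ x₀ = 0`):

* `exists_hyperbolic_partner` — a `y₀` with `B y₀ y₀ = 0`, `B x₀ y₀ = 1` (the hyperbolic plane through `x₀`,
  [Lang2002, Ch. XV §5]; [Serre1973, Ch. IV §1.3, Prop. 3] for the symmetric case);
* **`exists_hyperbolicFrame`** — moreover an ORTHOGONAL BASIS `b₁, …, b_m` of the orthogonal complement of that plane with
  `B bⱼ bⱼ = αⱼ`, `αⱼ ≠ 0`, `J αⱼ = αⱼ`, and the EXPANSION of every vector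
  `v = (B y₀ v) x₀ + (B x₀ v) y₀ + Σⱼ (αⱼ⁻¹ B bⱼ v) bⱼ` (Witt decomposition `V = (K x₀ ⊕ K y₀) ⊥ V₀` with an orthogonal
  basis of `V₀` from `exists_orthogonal_basis_of_isSymm`).

Written for the cell `hodgecm-mathlib` (fan B, rung B-IV): the frame is the coordinate system of the Schrödinger model
adapted to an isotropic line of `(E_vᴺ, T ⊗ 1)` in the Heisenberg-parabolic proof of
`MoeglinVignerasWaldspurger1987.mvw_IV4_rankOne_irreducibleOrZero`.  Nothing else is asserted.

## References
* [Lang2002] S. Lang, *Algebra*, rev. 3rd ed., GTM 211 (2002), Ch. XV §5 (hermitian forms), §3 (hyperbolic planes).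
* [Serre1973] J.-P. Serre, *A Course in Arithmetic*, GTM 7, Ch. IV §1.3 Prop. 3.
-/

set_option autoImplicit false

open Module

namespace Literature.LinearAlgebra.Semilinear

variable {K : Type*} [Field K] {V : Type*} [AddCommGroup V] [Module K V] {J : K →+* K}
  {B : V →ₛₗ[J] V →ₗ[K] K}

/-- **hyperbolic partner of an isotropic vector**: for `B` hermitian non-degenerate, `2 ≠ 0`, and `x₀ ≠ 0` with
`B x₀ x₀ = 0`, there is `y₀` with `B y₀ y₀ = 0` and `B x₀ y₀ = 1`.  (Scale a `z` with `B x₀ z ≠ 0` to `B x₀ z = 1`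
and correct by `-½ B(z,z) · x₀`.) [cite: Lang2002, Ch. XV §5] -/
theorem exists_hyperbolic_partner (hB : B.IsSymm) (hBnd : B.SeparatingLeft) (h2 : (2 : K) ≠ 0)
    {x₀ : V} (hx₀ : x₀ ≠ 0) (hiso : B x₀ x₀ = 0) : ∃ y₀ : V, B y₀ y₀ = 0 ∧ B x₀ y₀ = 1 := by
  -- a vector pairing non-trivially with `x₀`
  have hz : ∃ z, B x₀ z ≠ 0 := by
    by_contra h
    push Not at h
    exact hx₀ (hBnd x₀ h)
  obtain ⟨z, hz⟩ := hz
  set z' : V := (B x₀ z)⁻¹ • z with hz'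
  have hz'1 : B x₀ z' = 1 := by rw [hz', map_smul, smul_eq_mul, inv_mul_cancel₀ hz]
  have hz'1' : B z' x₀ = 1 := by rw [← hB.eq, hz'1, map_one]
  set κ : K := B z' z' with hκ
  have hκJ : J κ = κ := hB.eq _ _
  refine ⟨z' + (-(2⁻¹ * κ)) • x₀, ?_, ?_⟩
  · have hJ2 : J (2⁻¹ : K) = 2⁻¹ := by rw [map_inv₀, map_ofNat]
    simp only [map_add, LinearMap.add_apply, map_smul, LinearMap.map_smulₛₗ₂, smul_eq_mul,
      hz'1, hz'1', hiso, map_neg, map_mul, hJ2, hκJ, mul_zero, mul_one]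
    rw [← hκ]
    have h22 : (2⁻¹ : K) * 2 = 1 := inv_mul_cancel₀ h2
    linear_combination (-κ) * h22
  · simp only [map_add, map_smul, smul_eq_mul, hiso, mul_zero, add_zero]
    exact hz'1

variable [FiniteDimensional K V]

/-- **adapted (Witt) frame through an isotropic vector.**  For `B` hermitian non-degenerate over a field with `2 ≠ 0` and
an endomorphism `J` with `J δ = -δ ≠ 0`, and `x₀ ≠ 0` isotropic: there are a hyperbolic partner `y₀` (`B y₀ y₀ = 0`,
`B x₀ y₀ = 1`), an orthogonal family `b : Fin m → V` orthogonal to `x₀, y₀` with `B bⱼ bⱼ = αⱼ`, `αⱼ ≠ 0`, `J αⱼ = αⱼ`,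
and every vector expands as `v = (B y₀ v) x₀ + (B x₀ v) y₀ + Σⱼ (αⱼ⁻¹ B bⱼ v) bⱼ`. [cite: Lang2002, Ch. XV §5] -/
theorem exists_hyperbolicFrame (hB : B.IsSymm) (hBnd : B.SeparatingLeft) (h2 : (2 : K) ≠ 0) {δ : K} (hδ : δ ≠ 0)
    (hJδ : J δ = -δ) {x₀ : V} (hx₀ : x₀ ≠ 0) (hiso : B x₀ x₀ = 0) :
    ∃ (y₀ : V) (m : ℕ) (b : Fin m → V) (α : Fin m → K),
      B y₀ y₀ = 0 ∧ B x₀ y₀ = 1 ∧ (∀ j, B x₀ (b j) = 0) ∧ (∀ j, B y₀ (b j) = 0) ∧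
      (∀ j j', j ≠ j' → B (b j) (b j') = 0) ∧ (∀ j, B (b j) (b j) = α j) ∧ (∀ j, α j ≠ 0) ∧ (∀ j, J (α j) = α j) ∧
      ∀ v : V, v = B y₀ v • x₀ + B x₀ v • y₀ + ∑ j, ((α j)⁻¹ * B (b j) v) • b j := by
  classical
  obtain ⟨y₀, hy₀, hxy⟩ := exists_hyperbolic_partner hB hBnd h2 hx₀ hiso
  have hyx : B y₀ x₀ = 1 := by rw [← hB.eq, hxy, map_one]
  -- the orthogonal complement of the hyperbolic plane and an orthogonal basis of it
  let V₀ : Submodule K V := LinearMap.ker (B x₀) ⊓ LinearMap.ker (B y₀)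
  have hV₀ : ∀ v : V, v ∈ V₀ ↔ B x₀ v = 0 ∧ B y₀ v = 0 := fun v => by
    simp only [V₀, Submodule.mem_inf, LinearMap.mem_ker]
  let B₀ := B.domRestrict₁₂ V₀ V₀
  obtain ⟨w, hw⟩ := exists_orthogonal_basis_of_isSymm (V := V₀) (B := B₀) h2 hδ hJδ (hB.domRestrict V₀)
  -- the frame
  let b : Fin (finrank K V₀) → V := fun j => (w j : V)
  have hbV₀ : ∀ j, B x₀ (b j) = 0 ∧ B y₀ (b j) = 0 := fun j => (hV₀ _).1 (w j).2
  have hborth : ∀ j j', j ≠ j' → B (b j) (b j') = 0 := fun j j' hjj' => by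
    have := hw hjj'
    simp only [Function.onFun, B₀, LinearMap.domRestrict₁₂_apply] at this
    exact this
  -- the projection onto `V₀` and the expansion along `w`
  have hproj : ∀ v : V, v - B y₀ v • x₀ - B x₀ v • y₀ ∈ V₀ := by
    intro v
    rw [hV₀]
    constructor
    · simp only [map_sub, map_smul, smul_eq_mul, hiso, hxy, mul_zero, sub_zero, mul_one, sub_self]
    · simp only [map_sub, map_smul, smul_eq_mul, hy₀, hyx, mul_zero, mul_one, sub_self]
  have hexp : ∀ v : V, ∃ c : Fin (finrank K V₀) → K, v = B y₀ v • x₀ + B x₀ v • y₀ + ∑ j, c j • b j := by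
    intro v
    refine ⟨fun j => w.repr ⟨_, hproj v⟩ j, ?_⟩
    have hsum := w.sum_repr ⟨_, hproj v⟩
    have hcoe := congr_arg (Submodule.subtype V₀) hsum
    rw [map_sum] at hcoe
    simp only [map_smul, Submodule.subtype_apply] at hcoe
    rw [hcoe]
    abel
  -- coefficients by pairing with `b j`
  have hcoef : ∀ (v : V) (c : Fin (finrank K V₀) → K), v = B y₀ v • x₀ + B x₀ v • y₀ + ∑ j, c j • b j →
      ∀ j, B (b j) v = c j * B (b j) (b j) := by
    intro v c hv j
    have hbx : B (b j) x₀ = 0 := by rw [← hB.eq, (hbV₀ j).1, map_zero]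
    have hby : B (b j) y₀ = 0 := by rw [← hB.eq, (hbV₀ j).2, map_zero]
    conv_lhs => rw [hv]
    rw [map_add, map_add, map_smul, map_smul, map_sum, smul_eq_mul, smul_eq_mul, hbx, hby, mul_zero, mul_zero,
      zero_add, zero_add, Finset.sum_eq_single j]
    · rw [map_smul, smul_eq_mul]
    · intro j' _ hj'
      rw [map_smul, smul_eq_mul, hborth j j' (Ne.symm hj'), mul_zero]
    · intro hj; exact absurd (Finset.mem_univ j) hj
  -- `α j = B (b j) (b j) ≠ 0` (non-degeneracy)
  have hα : ∀ j, B (b j) (b j) ≠ 0 := by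
    intro j h0
    apply w.ne_zero j
    have hbj0 : (b j : V) = 0 := by
      refine hBnd (b j) fun v => ?_
      obtain ⟨c, hc⟩ := hexp v
      rw [hcoef v c hc j, h0, mul_zero]
    exact Subtype.ext hbj0
  refine ⟨y₀, finrank K V₀, b, fun j => B (b j) (b j), hy₀, hxy, fun j => (hbV₀ j).1, fun j => (hbV₀ j).2, hborth,
    fun j => rfl, hα, fun j => hB.eq _ _, fun v => ?_⟩
  obtain ⟨c, hc⟩ := hexp v
  have hc' : ∀ j, (B (b j) (b j))⁻¹ * B (b j) v = c j := fun j => by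
    rw [hcoef v c hc j, mul_comm, mul_inv_cancel_right₀ (hα j)]
  simp_rw [hc']
  exact hc

end Literature.LinearAlgebra.Semilinear
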